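import Mathlib

/-!
# Tier4/Common/LpInfiniteOfHaar — `L²` of a positive-measure set with compact closure is infinite-dimensional

Blind re-derivation cell `pub-hodge-repro`, Tier 4 «PROVE THE STEP» (README §9–§10), LINE L4, seat t4-L3-p1 (gen 3),
cut C-L4-LPINF (plan-4 S15084 / lead S15050; bus S15096): the GENERIC half (A) of display (10) `l4_lpInfinite`.

For a Haar measure `μ` on a second-countable locally compact Hausdorff topological group `G` in which `1` is not
isolated, and a measurable `S` of positive measure with compact closure, `L²(μ|_S)` is NOT finite-dimensional.

PROOF.  `1` not isolated + Haar ⇒ `μ {1} = 0` (Mathlib `IsHaarMeasure.nullSingletonClass`); Haar is locally finite on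
the σ-compact metrizable `G`, hence regular, so there is an open `U ∋ 1` with `μ U < μ S / 2`; finitely many translates
`x • U` cover the compact `closure S`, so some `S ∩ x • U` has positive measure, `≤ μ (x • U) = μ U < μ S / 2`
(left invariance), and then `S \ x • U` has positive measure too: every positive-measure measurable set with compact
closure SPLITS (`exists_split`).  Iterating the split gives a sequence of pairwise disjoint measurable subsets of `S` of
positive (finite) measure (`exists_disjoint_seq`), whose `L²` indicators are linearly independent
(`L2.inner_indicatorConstLp_indicatorConstLp`: the Gram matrix is diagonal with positive entries), and a finite-dimensional
space has no infinite linearly independent family (`Module.Finite.not_linearIndependent_of_infinite`).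

Imports: Mathlib only.  `#print axioms` = `[propext, Classical.choice, Quot.sound]`.  No printed input is consumed.
Nothing here asserts anything about the truth of (P); HC_CM is NOT proved by anyone in this repository.
-/

set_option autoImplicit false

noncomputable section

namespace Summit.Ventures.HodgeRepro.Tier4.Common

open MeasureTheory Topology Filter Set Function
open scoped Pointwise ENNReal

section Split

variable {G : Type*} [Group G] [TopologicalSpace G] [IsTopologicalGroup G] [T2Space G] [LocallyCompactSpace G]
  [SecondCountableTopology G] [MeasurableSpace G] [BorelSpace G]

/-- A Haar measure on a second-countable locally compact Hausdorff group is regular. -/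
theorem regular_of_isHaarMeasure (μ : Measure G) [μ.IsHaarMeasure] : μ.Regular := by
  haveI := TopologicalSpace.metrizableSpace_of_t3_secondCountable G
  infer_instance

/-- **THE SPLIT**: a measurable set of positive measure with compact closure contains two disjoint measurable subsets of
positive measure (one of them `S ∩ x • U`, the other `S \ x • U`, for a small open `U ∋ 1` and a translate). -/
theorem exists_split (μ : Measure G) [μ.IsHaarMeasure] [(𝓝[≠] (1 : G)).NeBot] {S : Set G}
    (hSc : IsCompact (closure S)) (hpos : 0 < μ S) :
    ∃ V : Set G, MeasurableSet V ∧ 0 < μ (S ∩ V) ∧ 0 < μ (S \ V) := by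
  haveI := regular_of_isHaarMeasure μ
  have hfin : μ S < ∞ := (measure_mono subset_closure).trans_lt hSc.measure_lt_top
  have h1 : μ ({1} : Set G) = 0 := measure_singleton 1
  have hhalf : 0 < μ S / 2 := ENNReal.half_pos hpos.ne'
  obtain ⟨U, hU1, hUo, hUlt⟩ := Set.exists_isOpen_lt_of_lt ({1} : Set G) (μ S / 2) (by rw [h1]; exact hhalf)
  have hmem : (1 : G) ∈ U := hU1 (mem_singleton 1)
  -- the translates `x • U` cover the compact closure
  have hcover : closure S ⊆ ⋃ x : G, x • U := fun x _ =>
    mem_iUnion.2 ⟨x, by simpa using smul_mem_smul_set (a := x) hmem⟩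
  obtain ⟨t, ht⟩ := hSc.elim_finite_subcover (fun x : G => x • U) (fun x => hUo.smul x) hcover
  -- some piece `S ∩ x • U` has positive measure
  have hSsub : S ⊆ ⋃ x ∈ t, S ∩ x • U := by
    intro y hy
    obtain ⟨x, hx, hyx⟩ := mem_iUnion₂.1 (ht (subset_closure hy))
    exact mem_iUnion₂.2 ⟨x, hx, hy, hyx⟩
  have hsum : 0 < ∑ x ∈ t, μ (S ∩ x • U) :=
    lt_of_lt_of_le hpos ((measure_mono hSsub).trans (measure_biUnion_finset_le t _))
  obtain ⟨x, -, hx⟩ : ∃ x ∈ t, 0 < μ (S ∩ x • U) := by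
    by_contra hcon
    have : ∑ x ∈ t, μ (S ∩ x • U) = 0 :=
      Finset.sum_eq_zero fun x hx => by
        by_contra h
        exact hcon ⟨x, hx, pos_iff_ne_zero.2 h⟩
    rw [this] at hsum
    exact lt_irrefl _ hsum
  refine ⟨x • U, (hUo.smul x).measurableSet, hx, ?_⟩
  -- `μ (S ∩ x • U) ≤ μ U < μ S / 2`, so the complement in `S` is positive
  have hle : μ (S ∩ x • U) < μ S / 2 :=
    ((measure_mono inter_subset_right).trans_eq (measure_smul μ x U)).trans_lt hUlt
  have hsplit := measure_inter_add_sdiff S (hUo.smul x).measurableSet (μ := μ)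
  by_contra h0
  rw [not_lt, nonpos_iff_eq_zero] at h0
  rw [h0, add_zero] at hsplit
  rw [hsplit] at hle
  have : μ S / 2 < μ S := ENNReal.half_lt_self hpos.ne' hfin.ne
  exact lt_irrefl _ (hle.trans this)

/-- **DISJOINT SEQUENCE**: a measurable set of positive measure with compact closure contains a sequence of pairwise
disjoint measurable subsets of positive measure. -/
theorem exists_disjoint_seq (μ : Measure G) [μ.IsHaarMeasure] [(𝓝[≠] (1 : G)).NeBot] {S : Set G}
    (hS : MeasurableSet S) (hSc : IsCompact (closure S)) (hpos : 0 < μ S) :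
    ∃ A : ℕ → Set G, (∀ n, MeasurableSet (A n)) ∧ (∀ n, A n ⊆ S) ∧ (∀ n, 0 < μ (A n)) ∧
      Pairwise (Disjoint on A) := by
  -- the remainders: a nested sequence of positive-measure measurable sets with compact closure
  let P : Set G → Prop := fun R => MeasurableSet R ∧ IsCompact (closure R) ∧ 0 < μ R
  have step : ∀ R, P R → ∃ V : Set G, MeasurableSet V ∧ 0 < μ (R ∩ V) ∧ 0 < μ (R \ V) :=
    fun R hR => exists_split μ hR.2.1 hR.2.2
  choose! V hV using step
  -- `R n` = the n-th remainder, `A n = R n ∩ V (R n)`, `R (n+1) = R n \ V (R n)`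
  let R : ℕ → Set G := fun n => Nat.rec S (fun _ Rn => Rn \ V Rn) n
  have hR0 : R 0 = S := rfl
  have hRsucc : ∀ n, R (n + 1) = R n \ V (R n) := fun n => rfl
  have hPR : ∀ n, P (R n) := by
    intro n
    induction n with
    | zero => exact ⟨hS, hSc, hpos⟩
    | succ n ih =>
      rw [hRsucc]
      refine ⟨ih.1.diff (hV _ ih).1, ?_, (hV _ ih).2.2⟩
      exact ih.2.1.of_isClosed_subset isClosed_closure (closure_mono sdiff_subset)
  have hRmono : ∀ n, R (n + 1) ⊆ R n := fun n => by rw [hRsucc]; exact sdiff_subset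
  have hRle : ∀ m n, m ≤ n → R n ⊆ R m := by
    intro m n hmn
    induction hmn with
    | refl => exact subset_rfl
    | step h ih => exact (hRmono _).trans ih
  have hRS : ∀ n, R n ⊆ S := fun n => by simpa [hR0] using hRle 0 n (Nat.zero_le n)
  refine ⟨fun n => R n ∩ V (R n), fun n => (hPR n).1.inter (hV _ (hPR n)).1, fun n => inter_subset_left.trans (hRS n),
    fun n => (hV _ (hPR n)).2.1, ?_⟩
  -- disjointness: `A n ⊆ R n ⊆ R (m+1) = R m \ V (R m)` for `m < n`, while `A m ⊆ V (R m)`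
  have key : ∀ m n, m < n → Disjoint (R m ∩ V (R m)) (R n ∩ V (R n)) := by
    intro m n hmn
    have h1 : R n ∩ V (R n) ⊆ R m \ V (R m) := by
      refine inter_subset_left.trans ?_
      rw [← hRsucc]
      exact hRle (m + 1) n hmn
    exact Set.disjoint_left.2 fun y hy hy' => (h1 hy').2 hy.2
  intro m n hmn
  rcases lt_or_gt_of_ne hmn with h | h
  · exact key m n h
  · exact (key n m h).symm

end Split

section Lp

variable {G : Type*} [Group G] [TopologicalSpace G] [IsTopologicalGroup G] [T2Space G] [LocallyCompactSpace G]
  [SecondCountableTopology G] [MeasurableSpace G] [BorelSpace G]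

/-- **`L²` OF A POSITIVE-MEASURE SET WITH COMPACT CLOSURE IS INFINITE-DIMENSIONAL** (Haar measure, `1` not isolated):
the indicators of the disjoint sequence are linearly independent. -/
theorem not_finiteDimensional_Lp_restrict_of_isHaarMeasure (μ : Measure G) [μ.IsHaarMeasure]
    [(𝓝[≠] (1 : G)).NeBot] {S : Set G} (hS : MeasurableSet S) (hSc : IsCompact (closure S)) (hpos : 0 < μ S) :
    ¬ FiniteDimensional ℂ (Lp ℂ 2 (μ.restrict S)) := by
  obtain ⟨A, hAm, hAS, hApos, hAdisj⟩ := exists_disjoint_seq μ hS hSc hpos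
  have hfin : μ S < ∞ := (measure_mono subset_closure).trans_lt hSc.measure_lt_top
  -- the restricted measure of `A n` is `μ (A n)`, positive and finite
  have hrA : ∀ n, (μ.restrict S) (A n) = μ (A n) := fun n => by
    rw [Measure.restrict_apply (hAm n), inter_eq_left.2 (hAS n)]
  have hAne : ∀ n, (μ.restrict S) (A n) ≠ ∞ := fun n => by
    rw [hrA]; exact ((measure_mono (hAS n)).trans_lt hfin).ne
  -- the indicators in `L²(μ|_S)`
  let v : ℕ → Lp ℂ 2 (μ.restrict S) := fun n => indicatorConstLp 2 (hAm n) (hAne n) (1 : ℂ)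
  have hv : LinearIndependent ℂ v := by
    rw [linearIndependent_iff']
    intro s g hsum i hi
    -- inner product with `v i` kills every other term
    have hinner : ∀ j, inner ℂ (v i) (v j) = (((μ.restrict S) (A i ∩ A j)).toReal : ℂ) := fun j => by
      simp only [v]
      rw [L2.inner_indicatorConstLp_indicatorConstLp (hAm i) (hAm j) (hAne i) (hAne j)]
      simp [measureReal_def]
    have hii : inner ℂ (v i) (v i) = ((μ (A i)).toReal : ℂ) := by
      rw [hinner, inter_self, hrA]
    have hij : ∀ j, j ≠ i → inner ℂ (v i) (v j) = 0 := fun j hj => by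
      rw [hinner, Measure.restrict_apply ((hAm i).inter (hAm j)), (hAdisj (Ne.symm hj)).inter_eq, empty_inter,
        measure_empty]
      simp
    have h0 : inner ℂ (v i) (∑ j ∈ s, g j • v j) = 0 := by rw [hsum, inner_zero_right]
    rw [inner_sum] at h0
    simp only [inner_smul_right] at h0
    rw [Finset.sum_eq_single i (fun j _ hj => by rw [hij j hj, mul_zero]) (fun h => absurd hi h)] at h0
    rw [hii] at h0
    have hAi : ((μ (A i)).toReal : ℂ) ≠ 0 := by
      have : 0 < (μ (A i)).toReal :=
        ENNReal.toReal_pos (hApos i).ne' ((measure_mono (hAS i)).trans_lt hfin).ne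
      exact_mod_cast this.ne'
    exact (mul_eq_zero.1 h0).resolve_right hAi
  intro hfd
  exact Module.Finite.not_linearIndependent_of_infinite v hv

end Lp

end Summit.Ventures.HodgeRepro.Tier4.Common

end
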